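import Summits.PneNP.PneNP.Theorems.SymmetryBudgetWindowBarrierEntropyGameCircuit
import Summits.PneNP.PneNP.Theorems.SymmetryBudgetWindowBarrierEntropyGameHall
import Literature.Computability.Complexity.SymmetricWeisfeilerLemanSemantics
import Literature.Computability.AlgebraicComplexity.SymmetricThresholdTranslation

/-!
# Completeness of the entropy game, IIIa: semantics of the coset-refinement circuit — the gates
(dichotomy `WindowBarrier` stmt-PneNP-2145 / `NoHiddenOrder` stmt-PneNP-14781, route `PneNP/SymmetryBudget`)

Continuation of `…EntropyGameCircuit.lean`.  For the DAG `CosetGame.crDAG K T H` evaluated on an input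
matrix `x`, read as the graph `Gx = SimpleGraph.fromRel (x (·,·) = true)`, every gate computes what its
name says:

* `CosetGame.val_peq` — the point test `peq A P Q q` fires iff
  `#{ρ ∈ A | (P.out ρ) q.1 ~ (P.out ρ) q.2 in Gx} = #{ρ ∈ A | (Q.out ρ) q.1 ~ (Q.out ρ) q.2 in H}`, which is
  the point clause of the refinement (`CosetGame.exists_equiv_iff_card_filter_eq`, a two-class Hall);
* `CosetGame.val_beq` — the block test counts the `ρ ∈ A` whose sub-position `⟦P.out ρ⟧` is round-`r`
  related to the target position `D`, against the target's own count `mB`;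
* `CosetGame.val_rel_succ` — a `rel` gate of positive round is the conjunction of the previous round's
  gate and of all block and point tests.

The induction over the rounds (`val_rel`) and the output are in `…EntropyGameCircuitSem.lean`.
-/

-- `Summit.PneNP.PneNP.…` duplicates `PneNP` BY DESIGN (single-problem summit).
set_option linter.dupNamespace false

namespace Summit.PneNP.PneNP.Theorems

open Finset Literature.Computability.Complexity
open scoped Classical

namespace CosetGame

variable {n K T : ℕ}

noncomputable section

open Node

/-! ### Two-class Hall: matching a predicate along a bijection -/

/-- For predicates `p`, `q` on a finite type, a bijection `e` with `p a ↔ q (e a)` exists iff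
`#{p} = #{q}` (glue a bijection of the `p`-part with the `q`-part and one of the complements). -/
theorem exists_equiv_iff_card_filter_eq {α : Type*} [Fintype α] (p q : α → Prop) [DecidablePred p]
    [DecidablePred q] :
    (∃ e : α ≃ α, ∀ a, p a ↔ q (e a)) ↔ (univ.filter p).card = (univ.filter q).card := by
  constructor
  · rintro ⟨e, he⟩
    refine Finset.card_bij (fun a _ => e a) (fun a ha => ?_) (fun a _ b _ h => e.injective h)
      (fun b hb => ⟨e.symm b, ?_, e.apply_symm_apply b⟩)
    · simp only [mem_filter, mem_univ, true_and] at ha ⊢; exact (he a).1 ha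
    · simp only [mem_filter, mem_univ, true_and] at hb ⊢
      have h := he (e.symm b); rw [e.apply_symm_apply] at h; exact h.2 hb
  · intro h
    have h1 : Fintype.card {a // p a} = Fintype.card {a // q a} := by
      rw [Fintype.card_subtype, Fintype.card_subtype]; exact h
    have h2 : Fintype.card {a // ¬ p a} = Fintype.card {a // ¬ q a} := by
      rw [Fintype.card_subtype_compl, Fintype.card_subtype_compl, Fintype.card_subtype,
        Fintype.card_subtype, h]
    let e₁ : {a // p a} ≃ {a // q a} := Fintype.equivOfCardEq h1
    let e₂ : {a // ¬ p a} ≃ {a // ¬ q a} := Fintype.equivOfCardEq h2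
    refine ⟨(Equiv.sumCompl p).symm.trans ((Equiv.sumCongr e₁ e₂).trans (Equiv.sumCompl q)), fun a => ?_⟩
    by_cases ha : p a
    · simp only [Equiv.trans_apply, Equiv.sumCompl_symm_apply_of_pos ha, Equiv.sumCongr_apply,
        Sum.map_inl, Equiv.sumCompl_apply_inl]
      exact ⟨fun _ => (e₁ ⟨a, ha⟩).2, fun _ => ha⟩
    · simp only [Equiv.trans_apply, Equiv.sumCompl_symm_apply_of_neg ha, Equiv.sumCongr_apply,
        Sum.map_inr, Equiv.sumCompl_apply_inr]
      exact ⟨fun h' => absurd h' ha, fun h' => absurd h' (e₂ ⟨a, ha⟩).2⟩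

/-- Counting over an enumeration of a type group is counting over the group. -/
theorem card_filter_enumA {A : Ty n K} (p : A.1 → Prop) [DecidablePred p] :
    (univ.filter fun i : Fin (cardA A) => p (enumA A i)).card = (univ.filter p).card := by
  refine Finset.card_bij (fun i _ => enumA A i) (fun i hi => by simpa using hi)
    (fun i _ j _ h => (enumA A).injective h) (fun ρ hρ => ⟨(enumA A).symm ρ, by simpa using hρ, by simp⟩)

/-- Counts of pointwise equivalent predicates agree (whatever the decidability instances). -/
theorem card_filter_iff {α : Type*} (s : Finset α) (p q : α → Prop) [DecidablePred p] [DecidablePred q]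
    (h : ∀ a, p a ↔ q a) : (s.filter p).card = (s.filter q).card :=
  Finset.card_bij (fun a _ => a) (fun a ha => by simp only [mem_filter] at ha ⊢; exact ⟨ha.1, (h a).1 ha.2⟩)
    (fun _ _ _ _ e => e) (fun b hb => ⟨b, by simp only [mem_filter] at hb ⊢; exact ⟨hb.1, (h b).2 hb.2⟩, rfl⟩)

/-! ### Generalities on gate values -/

section GateShapes

variable (V : W n K T → Bool)

/-- A binary conjunction reads its two arguments. -/
theorem and_two_iff (f : Fin 2 → W n K T) :
    (GateFn.and 2).2 (fun a => V (f a)) = true ↔ (V (f 0) = true ∧ V (f 1) = true) := by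
  show decide (∀ a : Fin 2, V (f a) = true) = true ↔ _
  rw [decide_eq_true_iff, Fin.forall_fin_two]

/-- A negation gate negates its argument. -/
theorem not_iff (f : Fin 1 → W n K T) : GateFn.not.2 (fun a => V (f a)) = true ↔ V (f 0) = false := by
  show (!(V (f 0))) = true ↔ _
  cases V (f 0) <;> simp

/-- An unbounded conjunction. -/
theorem and_fin_iff {N : ℕ} (f : Fin N → W n K T) :
    (GateFn.and N).2 (fun a => V (f a)) = true ↔ ∀ a, V (f a) = true := by
  show decide (∀ a : Fin N, V (f a) = true) = true ↔ _
  rw [decide_eq_true_iff]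

/-- An unbounded disjunction. -/
theorem or_fin_iff {N : ℕ} (f : Fin N → W n K T) :
    (GateFn.or N).2 (fun a => V (f a)) = true ↔ ∃ a, V (f a) = true := by
  show decide (∃ a : Fin N, V (f a) = true) = true ↔ _
  rw [decide_eq_true_iff]

/-- **The padded counter**: `MAJ_{2(N+1)}` over `(ff, f₀, …, f_{N-1})` and the threshold-`θ` padding
fires iff at least `θ` of the wires `fᵢ` are true. -/
theorem counter_iff (hff : V (Sum.inr ff) = false) (htt : V (Sum.inr tt) = true) {N θ : ℕ}
    (f : Fin N → W n K T) :
    (GateFn.maj ((N + 1) + (N + 1))).2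
        (fun a => V (Fin.append (Fin.cons (Sum.inr ff) f) (pad N θ) a)) = true ↔
      θ ≤ (univ.filter fun i => V (f i) = true).card := by
  show decide ((N + 1) + (N + 1) ≤ 2 * GateFn.numOnes
    (fun a => V (Fin.append (Fin.cons (Sum.inr ff) f) (pad N θ) a))) = true ↔ _
  rw [decide_eq_true_iff]
  have happ : (fun a => V (Fin.append (Fin.cons (Sum.inr ff) f) (pad N θ) a)) =
      Fin.append (Fin.cons false fun i => V (f i)) (fun j => decide ((j : ℕ) + θ < N + 1)) := by
    funext a
    induction a using Fin.addCases with
    | left i =>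
      rw [Fin.append_left, Fin.append_left]
      refine Fin.cases ?_ (fun i => ?_) i
      · simp [hff]
      · simp
    | right j =>
      rw [Fin.append_right, Fin.append_right]
      simp only [pad]
      split_ifs with h
      · simp [htt, h]
      · simp [hff, h]
  rw [happ, Literature.Computability.AlgebraicComplexity.LabelledArithCircuit.numOnes_append,
    SymWL.numOnes_cons_false, SymCR.numOnes_decide]
  have hdef : GateFn.numOnes (fun i => V (f i)) = (univ.filter fun i => V (f i) = true).card := rfl
  rw [hdef]
  have hA := Finset.card_filter_le (univ : Finset (Fin N)) (fun i => V (f i) = true)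
  rw [Finset.card_univ, Fintype.card_fin] at hA
  rcases le_or_gt θ (N + 1) with hθ | hθ
  · rw [SymCR.card_filter_add_lt hθ]
    omega
  · have h0 : (univ.filter fun j : Fin (N + 1) => (j : ℕ) + θ < N + 1).card = 0 := by
      rw [Finset.card_eq_zero, Finset.filter_eq_empty_iff]
      intro j _
      omega
    rw [h0]
    omega

end GateShapes

/-! ### Values of the literal layer -/

section Values

variable (H : SimpleGraph (Fin n)) (x : Fin n × Fin n → Bool)

/-- The defining equation of gate values. -/
theorem val_node (l : Node n K T) : (crDAG K T H).val x l =
    (Node.fn l).2 (fun a => GateDAG.wire x ((crDAG K T H).val x) (Node.args H l a)) :=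
  GateDAG.val_eq _ _ _

/-- The constant-true gate. -/
theorem val_tt : (crDAG K T H).val x tt = true := by
  rw [val_node]
  show decide (∀ a : Fin 0, GateDAG.wire x ((crDAG K T H).val x) (Fin.elim0 a) = true) = true
  simp

/-- The constant-false gate. -/
theorem val_ff : (crDAG K T H).val x ff = false := by
  rw [val_node]
  show decide (∃ a : Fin 0, GateDAG.wire x ((crDAG K T H).val x) (Fin.elim0 a) = true) = false
  simp

/-- The symmetrised-entry gate. -/
theorem val_ex (u v : Fin n) :
    (crDAG K T H).val x (ex u v) = true ↔ (x (u, v) = true ∨ x (v, u) = true) := by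
  rw [val_node]
  show decide (∃ a : Fin 2, GateDAG.wire x ((crDAG K T H).val x)
    (if (a : ℕ) = 0 then Sum.inl (u, v) else Sum.inl (v, u)) = true) = true ↔ _
  rw [decide_eq_true_iff, Fin.exists_fin_two]
  simp

/-- **A literal wire fires iff its two vertices are adjacent** in `SimpleGraph.fromRel (x (·,·) = true)`. -/
theorem wire_litW (u v : Fin n) :
    GateDAG.wire x ((crDAG K T H).val x) (litW u v : W n K T) = true ↔
      (SimpleGraph.fromRel fun a b : Fin n => x (a, b) = true).Adj u v := by
  rw [SimpleGraph.fromRel_adj]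
  simp only [litW]
  split_ifs with h
  · simp [GateDAG.wire_inr, val_ff, h]
  · rw [GateDAG.wire_inr, val_ex]
    simp [h]

local notation "Gx" => (SimpleGraph.fromRel fun a b : Fin n => x (a, b) = true)

/-! ### The point tests -/

/-- The literal wires counted by the point tests of `(A, P, q)`. -/
abbrev plit {A : Ty n K} (P : Cos A) (q : Fin n × Fin n) (i : Fin (cardA A)) : W n K T :=
  litW ((P.out * (enumA A i : Equiv.Perm (Fin n))) q.1) ((P.out * (enumA A i : Equiv.Perm (Fin n))) q.2)

/-- `pge`: at least `mP H Q q` of the point literals fire. -/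
theorem val_pge {A : Ty n K} (P Q : Cos A) (q : Fin n × Fin n) :
    (crDAG K T H).val x (pge A P Q q) = true ↔
      mP H Q q ≤ (univ.filter fun i : Fin (cardA A) =>
        GateDAG.wire x ((crDAG K T H).val x) (plit (T := T) P q i) = true).card := by
  rw [val_node]
  show (GateFn.maj ((cardA A + 1) + (cardA A + 1))).2 (fun a => GateDAG.wire x ((crDAG K T H).val x)
    (Fin.append (Fin.cons (Sum.inr ff) fun i => plit P q i) (pad (cardA A) (mP H Q q)) a)) = true ↔ _
  rw [counter_iff _ (by simp [val_ff]) (by simp [val_tt])]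

/-- `pgt`: at least `mP H Q q + 1` of them. -/
theorem val_pgt {A : Ty n K} (P Q : Cos A) (q : Fin n × Fin n) :
    (crDAG K T H).val x (pgt A P Q q) = true ↔
      mP H Q q + 1 ≤ (univ.filter fun i : Fin (cardA A) =>
        GateDAG.wire x ((crDAG K T H).val x) (plit (T := T) P q i) = true).card := by
  rw [val_node]
  show (GateFn.maj ((cardA A + 1) + (cardA A + 1))).2 (fun a => GateDAG.wire x ((crDAG K T H).val x)
    (Fin.append (Fin.cons (Sum.inr ff) fun i => plit P q i) (pad (cardA A) (mP H Q q + 1)) a)) = true ↔ _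
  rw [counter_iff _ (by simp [val_ff]) (by simp [val_tt])]

/-- `peq`: EXACTLY `mP H Q q` of them. -/
theorem val_peq {A : Ty n K} (P Q : Cos A) (q : Fin n × Fin n) :
    (crDAG K T H).val x (peq A P Q q) = true ↔
      (univ.filter fun i : Fin (cardA A) =>
        GateDAG.wire x ((crDAG K T H).val x) (plit (T := T) P q i) = true).card = mP H Q q := by
  have hn : (crDAG K T H).val x (npgt A P Q q) = true ↔
      ¬ (mP H Q q + 1 ≤ (univ.filter fun i : Fin (cardA A) =>
        GateDAG.wire x ((crDAG K T H).val x) (plit (T := T) P q i) = true).card) := by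
    rw [val_node, ← val_pgt (T := T) H x P Q q]
    show GateFn.not.2 (fun a => GateDAG.wire x ((crDAG K T H).val x) (Sum.inr (pgt A P Q q))) = true ↔ _
    rw [not_iff]
    simp
  rw [val_node]
  show (GateFn.and 2).2 (fun a => GateDAG.wire x ((crDAG K T H).val x)
    (if (a : ℕ) = 0 then Sum.inr (pge A P Q q) else Sum.inr (npgt A P Q q))) = true ↔ _
  rw [and_two_iff]
  simp only [Fin.val_zero, ↓reduceIte, Fin.val_one, one_ne_zero, GateDAG.wire_inr, val_pge, hn]
  omega

/-- The count of firing point literals is the count of `ρ ∈ A` reading an edge of `Gr x`. -/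
theorem card_plit {A : Ty n K} (P : Cos A) (q : Fin n × Fin n) :
    (univ.filter fun i : Fin (cardA A) =>
        GateDAG.wire x ((crDAG K T H).val x) (plit (T := T) P q i) = true).card =
      (univ.filter fun ρ : A.1 => (Gx).Adj ((P.out * ρ) q.1) ((P.out * ρ) q.2)).card :=
  (card_filter_iff _ _ _ fun _ => wire_litW H x _ _).trans
    (card_filter_enumA (fun ρ : A.1 => (Gx).Adj ((P.out * ρ) q.1) ((P.out * ρ) q.2)))

/-! ### The block tests -/

/-- `bge`: at least `mB` of the `ρ ∈ A` have `rel r B ⟦P.out ρ⟧ D`. -/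
theorem val_bge (r : Fin T) {A : Ty n K} (P Q : Cos A) (BD : Pos n K) :
    (crDAG K T H).val x (bge r A P Q BD) = true ↔
      mB K H r Q BD.1 BD.2 ≤
        (univ.filter fun i : Fin (cardA A) => (crDAG K T H).val x (rel r.castSucc BD.1 (child P BD.1 i) BD.2) = true).card := by
  rw [val_node]
  show (GateFn.maj ((cardA A + 1) + (cardA A + 1))).2 (fun a => GateDAG.wire x ((crDAG K T H).val x)
    (Fin.append (Fin.cons (Sum.inr ff) fun i => Sum.inr (rel r.castSucc BD.1 (child P BD.1 i) BD.2))
      (pad (cardA A) (mB K H r Q BD.1 BD.2)) a)) = true ↔ _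
  rw [counter_iff _ (by simp [val_ff]) (by simp [val_tt])]
  simp only [GateDAG.wire_inr]

/-- `bgt`: at least `mB + 1` of them. -/
theorem val_bgt (r : Fin T) {A : Ty n K} (P Q : Cos A) (BD : Pos n K) :
    (crDAG K T H).val x (bgt r A P Q BD) = true ↔
      mB K H r Q BD.1 BD.2 + 1 ≤
        (univ.filter fun i : Fin (cardA A) => (crDAG K T H).val x (rel r.castSucc BD.1 (child P BD.1 i) BD.2) = true).card := by
  rw [val_node]
  show (GateFn.maj ((cardA A + 1) + (cardA A + 1))).2 (fun a => GateDAG.wire x ((crDAG K T H).val x)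
    (Fin.append (Fin.cons (Sum.inr ff) fun i => Sum.inr (rel r.castSucc BD.1 (child P BD.1 i) BD.2))
      (pad (cardA A) (mB K H r Q BD.1 BD.2 + 1)) a)) = true ↔ _
  rw [counter_iff _ (by simp [val_ff]) (by simp [val_tt])]
  simp only [GateDAG.wire_inr]

/-- `beq`: EXACTLY `mB` of them. -/
theorem val_beq (r : Fin T) {A : Ty n K} (P Q : Cos A) (BD : Pos n K) :
    (crDAG K T H).val x (beq r A P Q BD) = true ↔
      (univ.filter fun i : Fin (cardA A) => (crDAG K T H).val x (rel r.castSucc BD.1 (child P BD.1 i) BD.2) = true).card =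
        mB K H r Q BD.1 BD.2 := by
  have hn : (crDAG K T H).val x (nbgt r A P Q BD) = true ↔
      ¬ (mB K H r Q BD.1 BD.2 + 1 ≤ (univ.filter fun i : Fin (cardA A) =>
          (crDAG K T H).val x (rel r.castSucc BD.1 (child P BD.1 i) BD.2) = true).card) := by
    rw [val_node, ← val_bgt H x r P Q BD]
    show GateFn.not.2 (fun a => GateDAG.wire x ((crDAG K T H).val x) (Sum.inr (bgt r A P Q BD))) = true ↔ _
    rw [not_iff]
    simp
  rw [val_node]
  show (GateFn.and 2).2 (fun a => GateDAG.wire x ((crDAG K T H).val x)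
    (if (a : ℕ) = 0 then Sum.inr (bge r A P Q BD) else Sum.inr (nbgt r A P Q BD))) = true ↔ _
  rw [and_two_iff]
  simp only [Fin.val_zero, ↓reduceIte, Fin.val_one, one_ne_zero, GateDAG.wire_inr, val_bge, hn]
  omega

/-- **Round `r + 1`**: `rel (r+1) A P Q` fires iff `rel r A P Q` does and all block and point tests do. -/
theorem val_rel_succ (r : ℕ) (hr : r + 1 < T + 1) {A : Ty n K} (P Q : Cos A) :
    (crDAG K T H).val x (rel ⟨r + 1, hr⟩ A P Q) = true ↔
      (crDAG K T H).val x (rel ⟨r, by omega⟩ A P Q) = true ∧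
      (∀ BD : Pos n K, (crDAG K T H).val x (beq ⟨r, by omega⟩ A P Q BD) = true) ∧
      (∀ q : Fin n × Fin n, (crDAG K T H).val x (peq A P Q q) = true) := by
  rw [val_node]
  show (GateFn.and (1 + (Fintype.card (Pos n K) + n * n))).2 (fun a => GateDAG.wire x ((crDAG K T H).val x)
    (Fin.append (fun _ : Fin 1 => (Sum.inr (rel ⟨r, by omega⟩ A P Q) : W n K T))
      (Fin.append (fun i => Sum.inr (beq ⟨r, by omega⟩ A P Q (enumPos n K i)))
        (fun i => Sum.inr (peq A P Q (finProdFinEquiv.symm i)))) a)) = true ↔ _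
  rw [and_fin_iff, Fin.forall_fin_add, Fin.forall_fin_add]
  simp only [Fin.append_left, Fin.append_right, GateDAG.wire_inr, Fin.forall_fin_one]
  refine and_congr_right fun _ => and_congr ?_ ?_
  · exact (enumPos n K).forall_congr_right (q := fun BD => (crDAG K T H).val x (beq ⟨r, by omega⟩ A P Q BD) = true)
  · exact finProdFinEquiv.symm.forall_congr_right (q := fun q => (crDAG K T H).val x (peq A P Q q) = true)

end Values

end

end CosetGame

end Summit.PneNP.PneNP.Theorems
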